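import Summits.MatrixMultiplication.MatrixMultiplication.Theorems.ObstructionCalculusSchurWeyl
import Summits.MatrixMultiplication.MatrixMultiplication.Theorems.ObstructionCalculusSlots

set_option linter.dupNamespace false
set_option autoImplicit false

/-!
# The obstruction calculus — SCHUR–WEYL BRIDGE, converse direction: the two occurrence models COINCIDE
(decomp-mm · lens 3 · gen 29, def-free)

Route-free calculus part (imports `ObstructionCalculusSchurWeyl`, `…Slots` — no `Theses` file, lint `theses-cone`), SUPPORTING the
crux `NoOccurrenceObstruction` (`P_O`, stmt 29040) of `route-MatrixMultiplication-ObstructionDescent`; consumed against the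
route decl in `ObstructionDescentSchurWeylObligation`.  NODE-g29 §2.

`ObstructionCalculusSchurWeyl` proved direction ⟸ of the dictionary between the route's obstruction calculus ("the type
`(Λ,d)` OCCURS for `t`" = `¬ hwvSpace Λ d ≤ orbitVanishing t`) and the Literature's isotypic model of Bürgisser–Ikenmeyer's
semigroup `S(t)` ("`λ ⊢ d` occurs in `t^{⊗d}`" = `isotypicSum₁ λ⁰ (isotypicSum₂ λ¹ (isotypicSum₃ λ² (kroneckerPow t d))) ≠ 0`),
for the REVERSED type `Λ s (rev i) = λˢ_i`.  This file proves ⟹ and records the EQUIVALENCE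
(`not_hwvSpace_le_orbitVanishing_iff_isotypicSum_ne_zero`) — the lens's one certified translation, on the crux's own objects.
* §1 POLARISATION (BI 2011 §10.1; the tree's symmetric arrays `arrOf`, `arrOf_linSubst` of `Hyperdeterminant`): the functional
  semi-invariance defining `hwvSpace` is the polynomial identity `K·F = χ_Λ(A,B,C)·F` for the Kronecker substitution `K`, so
  the symmetric array `ψ_F(u,v,w) = arrOf d F (u,v,w)` of a weight vector is an eigen-array of `(Aᵀ)^{⊗d} ⊗ (Bᵀ)^{⊗d} ⊗
  (Cᵀ)^{⊗d}`, `A, B, C ∈ B_m` (`actTensor_powMat_arrOf_of_mem_hwvSpace`).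
* §2 SLICES: every slice of the coordinate-reversed array `ψ_F∘rev³` is a highest-weight vector of the word model `(ℂ^m)^{⊗d}`
  (`arrOf_rev_mem_tripleHw`; the reversal turns the calculus' lower-triangular eigen-equation into the Literature's upper one).
* §3 THE BRIDGE ⟹ / ⟺: `F(t') = ⟪(t'∘rev³)^{⊗d}, ψ_F∘rev³⟫` (`evalT_eq_pairing_arrOf`), and a nonzero pairing of `s^{⊗d}` with
  `HW_{λ⁰} ⊗ HW_{λ¹} ⊗ HW_{λ²}` forces `λ` to occur in `s^{⊗d}` (`isotypicSum_ne_zero_of_pairing_tripleHw` — the tree's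
  `KroneckerPolytopeTangentMap` argument, re-proved since that module is not importable on the farm at present); corollary
  `isotypicSum_ne_zero_imp_of_hwvSpace_le_imp`: CALCULUS CONTAINMENT ⟹ SEMIGROUP CONTAINMENT `S(t') ⊆ S(t)`.

No proposition is defined; no `def`; sorry-free; standard axioms.  Nothing here proves `ω = 2` or closes an item.
[cite: BurgisserIkenmeyer2011, §3.1, §10.1] [cite: FultonHarrisGTM129, §15.3, §15.5, Lemma 6.22] [cite: Landsberg2017, §1.2]
-/


noncomputable section

open scoped BigOperators Matrix
open Finset

namespace Summit.MatrixMultiplication.MatrixMultiplication.Theorems.ObstructionCalculus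

open Literature.Computability.AlgebraicComplexity (actTensor actTensor_apply actTensor_actTensor actTensor_one kroneckerPow
  kroneckerPow_apply powMat powMat_apply powMat_one transpose_powMat sum_actTensor_mul sum_mul_actTensor
  kroneckerPow_actTensor_powMat isotypicSum₁ isotypicSum₂ isotypicSum₃ isotypicSum₁₂₃_ne_zero_iff
  isotypicSum₁₂₃_kroneckerPow_ne_zero_of_actTensor wordIsotypicMatrix_mulVec_of_mem_highestWeightSpace
  transpose_wordIsotypicMatrix wordRep_eq_powMat_mulVec arrOf arrOf_linSubst sum_arrOf_mul_prod_X linSubst)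
open Literature.NumberTheory.DiophantineGeometry (Word Word3 wordRep highestWeightSpace mem_highestWeightSpace_iff Weight
  IsUpperTriangular diag_ne_zero_of_isUpperTriangular tripleHw mem_tripleHw_iff)
open Literature.RepresentationTheory.FiniteGroups (wordIsotypicMatrix)

variable {m d : ℕ}

/-! ### §1 Polarisation: the symmetric array of a weight vector is a Borel eigen-array -/

/-- The action of `GL_m³` (indeed `Mat_m³`) on the calculus' polynomials is the LINEAR SUBSTITUTION by the Kronecker matrix
`K_{(a',b',c'),(a,b,c)} = A_{a a'} B_{b b'} C_{c c'}`: `F((A,B,C)·s) = (K·F)(s)`. [cite: Landsberg2017, §1.2] -/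
theorem evalT_linSubst (A B C : Matrix (Fin m) (Fin m) ℂ) (f : MvPolynomial (Idx m) ℂ) (s : Tensor ℂ m) :
    evalT s (linSubst (Idx m) ℂ (Matrix.of fun x i : Idx m => A i.1 x.1 * B i.2.1 x.2.1 * C i.2.2 x.2.2) f) =
      evalT (actTensor A B C s) f := by
  classical
  have h1 : linSubst (Idx m) ℂ (Matrix.of fun x i : Idx m => A i.1 x.1 * B i.2.1 x.2.1 * C i.2.2 x.2.2) f =
      MvPolynomial.bind₁ (fun i : Idx m => ∑ j : Idx m,
        (Matrix.of fun x i : Idx m => A i.1 x.1 * B i.2.1 x.2.1 * C i.2.2 x.2.2) j i •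
          (MvPolynomial.X j : MvPolynomial (Idx m) ℂ)) f := rfl
  have hpt : (fun i : Idx m => MvPolynomial.aeval (fun p : Idx m => s p.1 p.2.1 p.2.2) (∑ j : Idx m,
      (Matrix.of fun x i : Idx m => A i.1 x.1 * B i.2.1 x.2.1 * C i.2.2 x.2.2) j i •
        (MvPolynomial.X j : MvPolynomial (Idx m) ℂ))) =
      fun p : Idx m => actTensor A B C s p.1 p.2.1 p.2.2 := by
    funext i
    simp only [map_sum, map_smul, MvPolynomial.aeval_X, Matrix.of_apply, smul_eq_mul, actTensor_apply]
    rw [Fintype.sum_prod_type]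
    refine Finset.sum_congr rfl fun a _ => ?_
    rw [Fintype.sum_prod_type]
  rw [h1, evalT, evalT, MvPolynomial.aeval_bind₁, hpt]

/-- **Semi-invariance as a polynomial identity.**  For `F ∈ hwvSpace Λ d` and `A, B, C ∈ B_m`: `K·F = χ_Λ(A,B,C)·F` with `K`
the Kronecker substitution of `evalT_linSubst` (the defining functional identity holds at every point of `ℂ^{m³}`, and `ℂ` is
infinite). [cite: BurgisserIkenmeyer2011, §10.1] -/
theorem linSubst_eq_smul_of_mem_hwvSpace {Λ : Fin 3 → Fin m → ℕ} {F : MvPolynomial (Idx m) ℂ} (hF : F ∈ hwvSpace Λ d)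
    {A B C : Matrix (Fin m) (Fin m) ℂ} (hA : A ∈ borel m) (hB : B ∈ borel m) (hC : C ∈ borel m) :
    linSubst (Idx m) ℂ (Matrix.of fun x i : Idx m => A i.1 x.1 * B i.2.1 x.2.1 * C i.2.2 x.2.2) F =
      (weightChar (Λ 0) A * weightChar (Λ 1) B * weightChar (Λ 2) C) • F := by
  apply MvPolynomial.funext
  intro e
  have hev : ∀ G : MvPolynomial (Idx m) ℂ, MvPolynomial.eval e G = evalT (fun a b c => e (a, b, c)) G :=
    fun G => rfl
  rw [hev, hev, evalT_linSubst, map_smul, smul_eq_mul]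
  exact hF.2 A B C hA hB hC _

/-- The symmetric array is linear: `arrOf (c • q) = c • arrOf q`. [bookkeeping] -/
theorem arrOf_smul (c : ℂ) (q : MvPolynomial (Idx m) ℂ) (J : Fin d → Idx m) :
    arrOf d (c • q) J = c * arrOf d q J := by
  classical
  simp only [arrOf, MvPolynomial.coeff_smul, smul_eq_mul, mul_div_assoc]

/-- A sum over sequences `J : Fin d → Idx m` is a triple sum over words `(u,v,w)`, `J r = (u r, v r, w r)`. [bookkeeping] -/
theorem sum_seq_eq_sum_words (f : (Fin d → Idx m) → ℂ) :
    ∑ J : Fin d → Idx m, f J = ∑ u : Word m d, ∑ v : Word m d, ∑ w : Word m d, f (fun r => (u r, v r, w r)) := by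
  have h2 : (∑ u : Word m d, ∑ v : Word m d, ∑ w : Word m d, f (fun r => (u r, v r, w r))) =
      ∑ p : Word m d × (Word m d × Word m d), f (fun r => (p.1 r, p.2.1 r, p.2.2 r)) := by
    rw [Fintype.sum_prod_type]
    refine Finset.sum_congr rfl fun u _ => ?_
    rw [Fintype.sum_prod_type]
  rw [h2]
  exact Fintype.sum_equiv ⟨fun J => (fun r => (J r).1, fun r => (J r).2.1, fun r => (J r).2.2),
    fun p r => (p.1 r, p.2.1 r, p.2.2 r), fun J => rfl, fun p => rfl⟩ _ _ fun J => rfl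

/-- **The symmetric array of a weight vector is a Borel eigen-array.**  For `F ∈ hwvSpace Λ d` put `ψ_F(u,v,w) := arrOf d F
(r ↦ (u_r,v_r,w_r))` (`u, v, w : Fin d → Fin m`).  Then for all `A, B, C ∈ B_m`:
`((Aᵀ)^{⊗d} ⊗ (Bᵀ)^{⊗d} ⊗ (Cᵀ)^{⊗d}) ψ_F = χ_{Λ0}(A) χ_{Λ1}(B) χ_{Λ2}(C) · ψ_F` — the transformation law of symmetric arrays
under linear substitution (`arrOf_linSubst`) applied to `linSubst_eq_smul_of_mem_hwvSpace`.
[cite: BurgisserIkenmeyer2011, §10.1] [cite: FultonHarrisGTM129, §15.5] -/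
theorem actTensor_powMat_arrOf_of_mem_hwvSpace {Λ : Fin 3 → Fin m → ℕ} {F : MvPolynomial (Idx m) ℂ}
    (hF : F ∈ hwvSpace Λ d) {A B C : Matrix (Fin m) (Fin m) ℂ} (hA : A ∈ borel m) (hB : B ∈ borel m)
    (hC : C ∈ borel m) :
    actTensor (powMat Aᵀ d) (powMat Bᵀ d) (powMat Cᵀ d)
        (fun u v w : Word m d => arrOf d F (fun r => (u r, v r, w r))) =
      (weightChar (Λ 0) A * weightChar (Λ 1) B * weightChar (Λ 2) C) •
        (fun u v w : Word m d => arrOf d F (fun r => (u r, v r, w r))) := by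
  classical
  funext u v w
  have key := arrOf_linSubst (Matrix.of fun x i : Idx m => A i.1 x.1 * B i.2.1 x.2.1 * C i.2.2 x.2.2) hF.1
    (fun r => (u r, v r, w r))
  rw [linSubst_eq_smul_of_mem_hwvSpace hF hA hB hC, arrOf_smul, sum_seq_eq_sum_words] at key
  simp only [Pi.smul_apply, smul_eq_mul]
  rw [key, actTensor_apply]
  refine Finset.sum_congr rfl fun u' _ => Finset.sum_congr rfl fun v' _ => Finset.sum_congr rfl fun w' _ => ?_
  simp only [Matrix.of_apply, powMat_apply, Matrix.transpose_apply, Finset.prod_mul_distrib]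


/-! ### §2 Slices of the reversed array are highest-weight vectors of the word model -/

/-- **From the calculus' Borel to the Literature's.**  If `ξ : (Fin d → Fin m) → ℂ` satisfies `(Aᵀ)^{⊗d} ξ = χ_{Λ₀}(A) ξ`
for every `A ∈ B_m` (a LOWER-triangular eigen-equation), then the coordinate-reversed vector `u ↦ ξ(rev ∘ u)` is a
highest-weight vector of `(ℂ^m)^{⊗d}` of weight `λ`, where `Λ₀ (rev i) = λ_i` (conjugation by the longest Weyl element; for
`g` upper-triangular invertible, `A := (g∘(rev×rev))ᵀ ∈ B_m`). [cite: FultonHarrisGTM129, §15.3] -/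
theorem mem_highestWeightSpace_rev_of_powMat_transpose {lam : Nat.Partition d} {Λ₀ : Fin m → ℕ}
    (hΛ : ∀ i : Fin m, Λ₀ (Fin.rev i) = lam.sortedParts.getD i 0) {ξ : Word m d → ℂ}
    (hξ : ∀ A ∈ borel m, powMat Aᵀ d *ᵥ ξ = (weightChar Λ₀ A : ℂ) • ξ) :
    (fun u : Word m d => ξ (Fin.rev ∘ u)) ∈ highestWeightSpace (wordRep ℂ m d) (Weight.ofPartition m lam) := by
  classical
  rw [mem_highestWeightSpace_iff]
  intro g hg
  set A : Matrix (Fin m) (Fin m) ℂ := ((g : Matrix (Fin m) (Fin m) ℂ).submatrix Fin.rev Fin.rev)ᵀ with hAdef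
  have hA : A ∈ borel m := by
    refine ⟨fun i j hji => ?_, fun i => ?_⟩
    · simp only [hAdef, Matrix.transpose_apply, Matrix.submatrix_apply]
      exact hg (Fin.rev_lt_rev.2 hji)
    · simp only [hAdef, Matrix.transpose_apply, Matrix.submatrix_apply]
      exact diag_ne_zero_of_isUpperTriangular hg _
  have hact := hξ A hA
  rw [hAdef, Matrix.transpose_transpose] at hact
  rw [wordRep_eq_powMat_mulVec]
  funext u
  have h1 : (powMat (g : Matrix (Fin m) (Fin m) ℂ) d *ᵥ fun u' => ξ (Fin.rev ∘ u')) u =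
      (powMat ((g : Matrix (Fin m) (Fin m) ℂ).submatrix Fin.rev Fin.rev) d *ᵥ ξ) (Fin.rev ∘ u) := by
    simp only [Matrix.mulVec, dotProduct, powMat_apply, Matrix.submatrix_apply, Function.comp_apply, Fin.rev_rev]
    exact (Fintype.sum_equiv ⟨fun u' => Fin.rev ∘ u', fun u' => Fin.rev ∘ u', fun u' => by funext p; simp,
      fun u' => by funext p; simp⟩ _ _ fun u' => by simp [Function.comp_def, Fin.rev_rev]).symm
  rw [h1, hact, Pi.smul_apply, Pi.smul_apply, smul_eq_mul, smul_eq_mul]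
  congr 1
  simp only [Literature.NumberTheory.DiophantineGeometry.weightChar, Weight.ofPartition, Matrix.transpose_apply,
    Matrix.submatrix_apply, zpow_natCast, weightChar, ← hΛ]
  exact Fintype.prod_bijective Fin.rev Fin.rev_involutive.bijective _ _ fun i => by simp

/-- The `(u | v,w)`-slice as a matrix–vector product: `(P ⊗ 1 ⊗ 1) ψ (u,v,w) = (P · ψ(·,v,w)) u`. [bookkeeping] -/
theorem actTensor_one_one_eq_mulVec (P : Matrix (Word m d) (Word m d) ℂ) (ψ : Word m d → Word m d → Word m d → ℂ)
    (u v w : Word m d) : actTensor P 1 1 ψ u v w = (P *ᵥ fun u' => ψ u' v w) u := by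
  classical
  rw [actTensor_apply, Matrix.mulVec, dotProduct]
  refine Finset.sum_congr rfl fun u' _ => ?_
  rw [Finset.sum_eq_single v, Finset.sum_eq_single w]
  · simp
  · intro w' _ hw'; simp [Matrix.one_apply_ne' hw']
  · simp
  · intro v' _ hv'; simp [Matrix.one_apply_ne' hv']
  · simp

/-- The `(v | u,w)`-slice: `(1 ⊗ P ⊗ 1) ψ (u,v,w) = (P · ψ(u,·,w)) v`. [bookkeeping] -/
theorem one_actTensor_one_eq_mulVec (P : Matrix (Word m d) (Word m d) ℂ) (ψ : Word m d → Word m d → Word m d → ℂ)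
    (u v w : Word m d) : actTensor 1 P 1 ψ u v w = (P *ᵥ fun v' => ψ u v' w) v := by
  classical
  rw [actTensor_apply, Matrix.mulVec, dotProduct, Finset.sum_eq_single u]
  · refine Finset.sum_congr rfl fun v' _ => ?_
    rw [Finset.sum_eq_single w]
    · simp
    · intro w' _ hw'; simp [Matrix.one_apply_ne' hw']
    · simp
  · intro u' _ hu'; simp [Matrix.one_apply_ne' hu']
  · simp

/-- The `(w | u,v)`-slice: `(1 ⊗ 1 ⊗ P) ψ (u,v,w) = (P · ψ(u,v,·)) w`. [bookkeeping] -/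
theorem one_one_actTensor_eq_mulVec (P : Matrix (Word m d) (Word m d) ℂ) (ψ : Word m d → Word m d → Word m d → ℂ)
    (u v w : Word m d) : actTensor 1 1 P ψ u v w = (P *ᵥ fun w' => ψ u v w') w := by
  classical
  rw [actTensor_apply, Matrix.mulVec, dotProduct, Finset.sum_eq_single u]
  · rw [Finset.sum_eq_single v]
    · simp
    · intro v' _ hv'; simp [Matrix.one_apply_ne' hv']
    · simp
  · intro u' _ hu'; simp [Matrix.one_apply_ne' hu']
  · simp

/-- **Slices of the reversed array are highest-weight vectors.**  For `F ∈ hwvSpace Λ d` with `Λ s (rev i) = λˢ_i`, the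
reversed symmetric array `M(u,v,w) := ψ_F(rev∘u, rev∘v, rev∘w)` lies in `HW_{λ⁰} ⊗ HW_{λ¹} ⊗ HW_{λ²} ⊆ ((ℂ^m)^{⊗d})^{⊗3}`
(`tripleHw`): every slice in each of the three directions is a highest-weight vector of the word model.
[cite: BurgisserIkenmeyer2011, §10.1] [cite: FultonHarrisGTM129, §15.5] -/
theorem arrOf_rev_mem_tripleHw (lam : Fin 3 → Nat.Partition d) (Λ : Fin 3 → Fin m → ℕ)
    (hΛ : ∀ (s : Fin 3) (i : Fin m), Λ s (Fin.rev i) = (lam s).sortedParts.getD i 0)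
    {F : MvPolynomial (Idx m) ℂ} (hF : F ∈ hwvSpace Λ d) :
    (fun x : Word3 m d => arrOf d F (fun r => (Fin.rev (x.1.1 r), Fin.rev (x.1.2 r), Fin.rev (x.2 r)))) ∈
      tripleHw ℂ m d (Weight.ofPartition m (lam 0)) (Weight.ofPartition m (lam 1)) (Weight.ofPartition m (lam 2)) := by
  classical
  have h1 : (1 : Matrix (Fin m) (Fin m) ℂ) ∈ borel m := one_mem_borel
  have hw1 : ∀ L : Fin m → ℕ, weightChar L (1 : Matrix (Fin m) (Fin m) ℂ) = 1 := weightChar_one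
  rw [mem_tripleHw_iff]
  refine ⟨fun w₂ w₃ => ?_, fun w₁ w₃ => ?_, fun w₁ w₂ => ?_⟩
  · have hξ : ∀ A ∈ borel m, powMat Aᵀ d *ᵥ
        (fun u' : Word m d => arrOf d F (fun r => (u' r, Fin.rev (w₂ r), Fin.rev (w₃ r)))) =
        (weightChar (Λ 0) A : ℂ) • (fun u' : Word m d => arrOf d F (fun r => (u' r, Fin.rev (w₂ r), Fin.rev (w₃ r)))) := by
      intro A hA
      have h := actTensor_powMat_arrOf_of_mem_hwvSpace hF hA h1 h1
      rw [Matrix.transpose_one, powMat_one, hw1, hw1, mul_one, mul_one] at h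
      funext u
      have hu := congrFun (congrFun (congrFun h u) (Fin.rev ∘ w₂)) (Fin.rev ∘ w₃)
      rw [actTensor_one_one_eq_mulVec] at hu
      simpa only [Function.comp_apply, Pi.smul_apply] using hu
    exact mem_highestWeightSpace_rev_of_powMat_transpose (hΛ 0) hξ
  · have hξ : ∀ B ∈ borel m, powMat Bᵀ d *ᵥ
        (fun v' : Word m d => arrOf d F (fun r => (Fin.rev (w₁ r), v' r, Fin.rev (w₃ r)))) =
        (weightChar (Λ 1) B : ℂ) • (fun v' : Word m d => arrOf d F (fun r => (Fin.rev (w₁ r), v' r, Fin.rev (w₃ r)))) := by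
      intro B hB
      have h := actTensor_powMat_arrOf_of_mem_hwvSpace hF h1 hB h1
      rw [Matrix.transpose_one, powMat_one, hw1, hw1, one_mul, mul_one] at h
      funext v
      have hv := congrFun (congrFun (congrFun h (Fin.rev ∘ w₁)) v) (Fin.rev ∘ w₃)
      rw [one_actTensor_one_eq_mulVec] at hv
      simpa only [Function.comp_apply, Pi.smul_apply] using hv
    exact mem_highestWeightSpace_rev_of_powMat_transpose (hΛ 1) hξ
  · have hξ : ∀ C ∈ borel m, powMat Cᵀ d *ᵥ
        (fun w' : Word m d => arrOf d F (fun r => (Fin.rev (w₁ r), Fin.rev (w₂ r), w' r))) =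
        (weightChar (Λ 2) C : ℂ) • (fun w' : Word m d => arrOf d F (fun r => (Fin.rev (w₁ r), Fin.rev (w₂ r), w' r))) := by
      intro C hC
      have h := actTensor_powMat_arrOf_of_mem_hwvSpace hF h1 h1 hC
      rw [Matrix.transpose_one, powMat_one, hw1, hw1, one_mul, one_mul] at h
      funext w
      have hw := congrFun (congrFun (congrFun h (Fin.rev ∘ w₁)) (Fin.rev ∘ w₂)) w
      rw [one_one_actTensor_eq_mulVec] at hw
      simpa only [Function.comp_apply, Pi.smul_apply] using hw
    exact mem_highestWeightSpace_rev_of_powMat_transpose (hΛ 2) hξ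


/-! ### §3 The bridge: direction ⟹ and the equivalence of the two occurrence models -/

/-- **A value of a form is a pairing of its reversed array with a reversed Kronecker power**:
`F(t) = Σ_{u,v,w} (t∘rev³)^{⊗d}(u,v,w) · ψ_F(rev∘u, rev∘v, rev∘w)` (polarisation `F = Σ_J arrOf(F)(J)·∏_r X_{J r}`,
tree `sum_arrOf_mul_prod_X`, reindexed). [cite: BurgisserIkenmeyer2011, §10.1] -/
theorem evalT_eq_pairing_arrOf {F : MvPolynomial (Idx m) ℂ} (hF : F.IsHomogeneous d) (t : Tensor ℂ m) :
    evalT t F = ∑ u : Word m d, ∑ v : Word m d, ∑ w : Word m d,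
      kroneckerPow (fun a b c => t (Fin.rev a) (Fin.rev b) (Fin.rev c)) d u v w *
        arrOf d F (fun r => (Fin.rev (u r), Fin.rev (v r), Fin.rev (w r))) := by
  classical
  conv_lhs => rw [← sum_arrOf_mul_prod_X hF]
  simp only [evalT, map_sum, map_mul, map_prod, MvPolynomial.aeval_X, MvPolynomial.aeval_C,
    Algebra.algebraMap_self_apply, kroneckerPow_apply]
  rw [sum_seq_eq_sum_words]
  symm
  refine Fintype.sum_equiv ⟨fun u' => Fin.rev ∘ u', fun u' => Fin.rev ∘ u', fun u' => by funext p; simp,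
      fun u' => by funext p; simp⟩ _ _ fun u => ?_
  refine Fintype.sum_equiv ⟨fun u' => Fin.rev ∘ u', fun u' => Fin.rev ∘ u', fun u' => by funext p; simp,
      fun u' => by funext p; simp⟩ _ _ fun v => ?_
  refine Fintype.sum_equiv ⟨fun u' => Fin.rev ∘ u', fun u' => Fin.rev ∘ u', fun u' => by funext p; simp,
      fun u' => by funext p; simp⟩ _ _ fun w => ?_
  simp only [Equiv.coe_fn_mk, Function.comp_apply]
  ring

/-- **`HW ⊗ HW ⊗ HW` is fixed by the triple isotypic projector** (tree: `KroneckerPolytopeTangentMap.actTensor_wordIsotypicMatrix_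
of_mem_tripleHw`, re-proved because that module is not importable on the farm at present; the proof is the tree's):
`(P_{λ⁰} ⊗ P_{λ¹} ⊗ P_{λ²}) M = M` for `M ∈ tripleHw`. [cite: FultonHarrisGTM129, §6.1, Lemma 6.22] -/
theorem actTensor_wordIsotypicMatrix_of_mem_tripleHw' {lam mu nu : Nat.Partition d} {M : Word3 m d → ℂ}
    (hM : M ∈ tripleHw ℂ m d (Weight.ofPartition m lam) (Weight.ofPartition m mu) (Weight.ofPartition m nu)) :
    actTensor (wordIsotypicMatrix m d lam) (wordIsotypicMatrix m d mu) (wordIsotypicMatrix m d nu)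
      (fun u v w => M ((u, v), w)) = fun u v w => M ((u, v), w) := by
  rw [mem_tripleHw_iff] at hM
  obtain ⟨h₁, h₂, h₃⟩ := hM
  have e3 : actTensor (1 : Matrix (Word m d) (Word m d) ℂ) (1 : Matrix (Word m d) (Word m d) ℂ)
      (wordIsotypicMatrix m d nu) (fun u v w => M ((u, v), w)) = fun u v w => M ((u, v), w) := by
    funext u v w
    rw [one_one_actTensor_eq_mulVec, wordIsotypicMatrix_mulVec_of_mem_highestWeightSpace (h₃ u v)]
  have e2 : actTensor (1 : Matrix (Word m d) (Word m d) ℂ) (wordIsotypicMatrix m d mu)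
      (1 : Matrix (Word m d) (Word m d) ℂ) (fun u v w => M ((u, v), w)) = fun u v w => M ((u, v), w) := by
    funext u v w
    rw [one_actTensor_one_eq_mulVec, wordIsotypicMatrix_mulVec_of_mem_highestWeightSpace (h₂ u w)]
  have e1 : actTensor (wordIsotypicMatrix m d lam) (1 : Matrix (Word m d) (Word m d) ℂ)
      (1 : Matrix (Word m d) (Word m d) ℂ) (fun u v w => M ((u, v), w)) = fun u v w => M ((u, v), w) := by
    funext u v w
    rw [actTensor_one_one_eq_mulVec, wordIsotypicMatrix_mulVec_of_mem_highestWeightSpace (h₁ v w)]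
  calc actTensor (wordIsotypicMatrix m d lam) (wordIsotypicMatrix m d mu) (wordIsotypicMatrix m d nu)
        (fun u v w => M ((u, v), w))
      = actTensor (wordIsotypicMatrix m d lam) (1 : Matrix (Word m d) (Word m d) ℂ)
          (1 : Matrix (Word m d) (Word m d) ℂ)
          (actTensor (1 : Matrix (Word m d) (Word m d) ℂ) (wordIsotypicMatrix m d mu)
            (1 : Matrix (Word m d) (Word m d) ℂ)
            (actTensor (1 : Matrix (Word m d) (Word m d) ℂ) (1 : Matrix (Word m d) (Word m d) ℂ)
              (wordIsotypicMatrix m d nu) (fun u v w => M ((u, v), w)))) := by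
        rw [actTensor_actTensor, actTensor_actTensor]; simp
    _ = fun u v w => M ((u, v), w) := by rw [e3, e2, e1]

/-- **A nonzero pairing with `HW ⊗ HW ⊗ HW` witnesses occurrence** (tree: `KroneckerPolytopeTangentMap.isotypicSum₁₂₃_
kroneckerPow_ne_zero_of_pairing_tripleHw_ne_zero`, re-proved for the same reason): if `M ∈ HW_{λ⁰} ⊗ HW_{λ¹} ⊗ HW_{λ²}` and
`⟪s^{⊗d}, M⟫ ≠ 0` then `λ` occurs in `s^{⊗d}` — move the symmetric projector `P_{λ⁰} ⊗ P_{λ¹} ⊗ P_{λ²}` (which fixes `M`)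
across the pairing. [cite: BurgisserIkenmeyer2011, §3.1] [cite: FultonHarrisGTM129, Lemma 6.22] -/
theorem isotypicSum_ne_zero_of_pairing_tripleHw {lam : Fin 3 → Nat.Partition d} {M : Word3 m d → ℂ}
    (hM : M ∈ tripleHw ℂ m d (Weight.ofPartition m (lam 0)) (Weight.ofPartition m (lam 1))
      (Weight.ofPartition m (lam 2)))
    {s : Fin m → Fin m → Fin m → ℂ} (h : ∑ u, ∑ v, ∑ w, kroneckerPow s d u v w * M ((u, v), w) ≠ 0) :
    isotypicSum₁ (lam 0) (isotypicSum₂ (lam 1) (isotypicSum₃ (lam 2) (kroneckerPow s d))) ≠ 0 := by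
  rw [isotypicSum₁₂₃_ne_zero_iff]
  intro h0
  apply h
  have hfix := actTensor_wordIsotypicMatrix_of_mem_tripleHw' hM
  calc ∑ u, ∑ v, ∑ w, kroneckerPow s d u v w * M ((u, v), w)
      = ∑ u, ∑ v, ∑ w, kroneckerPow s d u v w *
          actTensor (wordIsotypicMatrix m d (lam 0)) (wordIsotypicMatrix m d (lam 1))
            (wordIsotypicMatrix m d (lam 2)) (fun u v w => M ((u, v), w)) u v w := by rw [hfix]
    _ = 0 := by
        rw [sum_mul_actTensor, transpose_wordIsotypicMatrix, transpose_wordIsotypicMatrix,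
          transpose_wordIsotypicMatrix, h0]
        simp

/-- **THE BRIDGE, direction ⟹.**  If the reversed partition type `(Λ, d)`, `Λ s (rev i) = λˢ_i`, OCCURS for `t` in the
calculus — some `F ∈ hwvSpace Λ d` does not vanish on `GL_m³·t` — then `λ = (λ⁰,λ¹,λ²)` occurs in `t^{⊗d}`, i.e. `(d;λ) ∈
S(t)` in the isotypic model: `F((A,B,C)t) = ⟪(((A,B,C)t)∘rev³)^{⊗d}, ψ_F∘rev³⟫ ≠ 0` with `ψ_F∘rev³ ∈ HW ⊗ HW ⊗ HW` (§2) gives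
occurrence in `(((A,B,C)t)∘rev³)^{⊗d} = ((A',B',C')t)^{⊗d}`, hence in `t^{⊗d}`.
[cite: BurgisserIkenmeyer2011, §3.1, §10.1] [cite: FultonHarrisGTM129, §15.3] -/
theorem isotypicSum_ne_zero_of_not_hwvSpace_le_orbitVanishing (t : Tensor ℂ m) (lam : Fin 3 → Nat.Partition d)
    (Λ : Fin 3 → Fin m → ℕ) (hΛ : ∀ (s : Fin 3) (i : Fin m), Λ s (Fin.rev i) = (lam s).sortedParts.getD i 0)
    (h : ¬ hwvSpace Λ d ≤ orbitVanishing t) :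
    isotypicSum₁ (lam 0) (isotypicSum₂ (lam 1) (isotypicSum₃ (lam 2) (kroneckerPow t d))) ≠ 0 := by
  classical
  obtain ⟨F, hF, hFnot⟩ := SetLike.not_le_iff_exists.1 h
  rw [mem_orbitVanishing] at hFnot
  push Not at hFnot
  obtain ⟨A, B, C, -, -, -, hne⟩ := hFnot
  rw [evalT_eq_pairing_arrOf hF.1] at hne
  have hrev : (fun a b c => actTensor A B C t (Fin.rev a) (Fin.rev b) (Fin.rev c)) =
      actTensor (A.submatrix Fin.rev id) (B.submatrix Fin.rev id) (C.submatrix Fin.rev id) t := by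
    funext a b c
    simp only [actTensor_apply, Matrix.submatrix_apply, id]
  rw [hrev] at hne
  exact isotypicSum₁₂₃_kroneckerPow_ne_zero_of_actTensor
    (isotypicSum_ne_zero_of_pairing_tripleHw (arrOf_rev_mem_tripleHw lam Λ hΛ hF) hne)

/-- **THE TWO OCCURRENCE MODELS COINCIDE.**  For a tensor `t ∈ ℂ^m ⊗ ℂ^m ⊗ ℂ^m`, partitions `λ⁰, λ¹, λ² ⊢ d` (if some `λˢ`
has more than `m` parts both sides are false) and the reversed type `Λ s (rev i) = λˢ_i`:
the type `(Λ,d)` occurs for `t` in the obstruction calculus (`¬ hwvSpace Λ d ≤ orbitVanishing t`: some weight vector of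
`ℂ[ℂ^{m³}]_d` of type `Λ` does not vanish on `GL_m³·t`) **iff** `λ` occurs in `t^{⊗d}` (`(d;λ) ∈ S(t)`, Bürgisser–Ikenmeyer).
[cite: BurgisserIkenmeyer2011, §3.1, §10.1] -/
theorem not_hwvSpace_le_orbitVanishing_iff_isotypicSum_ne_zero (t : Tensor ℂ m) (lam : Fin 3 → Nat.Partition d)
    (Λ : Fin 3 → Fin m → ℕ) (hΛ : ∀ (s : Fin 3) (i : Fin m), Λ s (Fin.rev i) = (lam s).sortedParts.getD i 0) :
    ¬ hwvSpace Λ d ≤ orbitVanishing t ↔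
      isotypicSum₁ (lam 0) (isotypicSum₂ (lam 1) (isotypicSum₃ (lam 2) (kroneckerPow t d))) ≠ 0 :=
  ⟨isotypicSum_ne_zero_of_not_hwvSpace_le_orbitVanishing t lam Λ hΛ,
    not_hwvSpace_le_orbitVanishing_of_isotypicSum_ne_zero t lam Λ hΛ⟩

/-- The same equivalence, positively: `hwvSpace Λ d ≤ orbitVanishing t` (every weight vector of the reversed type vanishes on
the orbit) iff `λ` does NOT occur in `t^{⊗d}`. [cite: BurgisserIkenmeyer2011, §3.1, §10.1] -/
theorem hwvSpace_le_orbitVanishing_iff_isotypicSum_eq_zero (t : Tensor ℂ m) (lam : Fin 3 → Nat.Partition d)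
    (Λ : Fin 3 → Fin m → ℕ) (hΛ : ∀ (s : Fin 3) (i : Fin m), Λ s (Fin.rev i) = (lam s).sortedParts.getD i 0) :
    hwvSpace Λ d ≤ orbitVanishing t ↔
      isotypicSum₁ (lam 0) (isotypicSum₂ (lam 1) (isotypicSum₃ (lam 2) (kroneckerPow t d))) = 0 := by
  have h := not_hwvSpace_le_orbitVanishing_iff_isotypicSum_ne_zero t lam Λ hΛ
  tauto

/-- **Calculus containment implies semigroup containment.**  If every reversed-partition type vanishing on the orbit of `t`
vanishes on the orbit of `t'` (containment of obstructions in the calculus, the shape of the crux `P_O`), then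
`S(t') ⊆ S(t)`: every triple occurring in a tensor power of `t'` occurs in the same power of `t`.
[cite: BurgisserIkenmeyer2011, §3.1] -/
theorem isotypicSum_ne_zero_imp_of_hwvSpace_le_imp (t t' : Tensor ℂ m)
    (h : ∀ (d : ℕ) (Λ : Fin 3 → Fin m → ℕ), hwvSpace Λ d ≤ orbitVanishing t → hwvSpace Λ d ≤ orbitVanishing t')
    (d : ℕ) (lam : Fin 3 → Nat.Partition d)
    (hocc : isotypicSum₁ (lam 0) (isotypicSum₂ (lam 1) (isotypicSum₃ (lam 2) (kroneckerPow t' d))) ≠ 0) :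
    isotypicSum₁ (lam 0) (isotypicSum₂ (lam 1) (isotypicSum₃ (lam 2) (kroneckerPow t d))) ≠ 0 := by
  set Λ : Fin 3 → Fin m → ℕ := fun s j => (lam s).sortedParts.getD (Fin.rev j) 0 with hΛdef
  have hΛ : ∀ (s : Fin 3) (i : Fin m), Λ s (Fin.rev i) = (lam s).sortedParts.getD i 0 := by
    intro s i
    simp only [hΛdef, Fin.rev_rev]
  have h' := not_hwvSpace_le_orbitVanishing_of_isotypicSum_ne_zero t' lam Λ hΛ hocc
  exact isotypicSum_ne_zero_of_not_hwvSpace_le_orbitVanishing t lam Λ hΛ fun hle => h' (h d Λ hle)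



end Summit.MatrixMultiplication.MatrixMultiplication.Theorems.ObstructionCalculus

end
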